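import Literature.NumberTheory.LFunctions.WeilCriterionProofs
import Literature.NumberTheory.LFunctions.WeilGroundEnergyParitySplit
import Summits.RiemannHypothesis.RiemannHypothesis.Theorems.PfPersistenceFloorRateDichotomy
import Summits.RiemannHypothesis.RiemannHypothesis.Theorems.SoloInformedGroundStateDecay2
import Summits.RiemannHypothesis.RiemannHypothesis.Theorems.WeilCombCombShapeDetection
import HarnessLib

/-!
# PF persistence campaign (cell `pub-rhpf`, seat cand-7, gen 9): COEFFICIENT RIGIDITY of window
positivity under a single-site perturbation — the hairline theorem

Mechanism/rigidity campaign; **no RH claims**.  Everything in this file is PROVED (Mathlib + tree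
theorems; no named fact, no `sorry`) and RH-FREE: RH appears only inside a `by_cases`.  DATA
enter the docstrings only, labelled DATA.

## The question
The campaign's controls (perturbation family "prime deletion") change ONE coefficient of the
explicit formula: deleting the prime power `n` from `ζ`'s weight table replaces Weil's functional
`W` by `W_{λ,x₀}(F) = W(F) + λ (F(x₀) + F(-x₀))`, `λ = Λ(n)/√n > 0`, `x₀ = log n`
(`siteFunctional`; a planted fake prime power is `λ < 0`).  How rigid is Weil positivity
`Re W(g ⋆ g̃) ≥ 0` — which is RH by Weil's criterion `weil_criterion_holds` — under it?

## Results (all PROVED, unconditional)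
* `exists_siteQuadratic_neg_of_test` — **detection by a cheap test**: if some test `φ` of radius
  `r < x₀/2` has `2·Re W(φ ⋆ φ̃) < |λ|·‖φ‖₂²`, then some test `g` has `Re W_{λ,x₀}(g ⋆ g̃) < 0`.
* `abs_le_two_mul_weilGroundEnergy_of_nonneg` — **the hairline**: a single-site perturbation at
  `x₀` that is positive on test functions has `|λ| ≤ 2 ε(r)` for EVERY `0 < r < x₀/2` (`ε = weilGroundEnergy`);
  with the RH-free double-exponential decay `weilGroundEnergy_exp_exp_decay` this is
  `|λ| ≤ 2C·exp(-c·e^{2r})` (`siteQuadratic_hairline`).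
* `siteQuadratic_zero_nonneg_iff_riemannHypothesis` — the centre `λ = 0` of the hairline is positive
  iff RH (imported criterion; nothing about RH is claimed).  Positivity hypotheses are stated inline
  (`∀ g, IsWeilTest g → 0 ≤ Re W_{λ,x₀}(g ⋆ g̃)`); no `Prop` is vendored.
Sequel (`PfPersistenceCoefficientRigidityDeletion.lean`): every prime-power / Euler-factor
deletion beyond a threshold is PROVED non-positive.

## Mechanism (why it is RH-free)
Case RH: Bombieri's polarisation `G = φ + c·φ(· - x₀)` (`WeilConverse.translateMix`).  By the
explicit formula `Re W(G ⋆ G̃) = 2 Re W(φ ⋆ φ̃) + 2 Re(c·B_φ(x₀))` with `|B_φ(x₀)| ≤ Re W(φ ⋆ φ̃)`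
(`WeilConverse.norm_expSum_le`), while disjointness of supports gives `(G ⋆ G̃)(x₀) = c‖φ‖₂²`
exactly; a phase `c` chosen against `B_φ(x₀) + λ‖φ‖₂²` makes
`Re W_{λ,x₀}(G ⋆ G̃) = 2w₀ - 2|B_φ(x₀) + λ‖φ‖₂²| < 0`.  Case ¬RH: the ground energy sinks below
`-2|λ|` on some window (`weilGroundEnergy_sinks_of_offline_zero`) and `|(g ⋆ g̃)(x)| ≤ ‖g‖₂²`.

DATA cross-reference (used in no proof): the campaign's Arb-certified `primedel` controls
(p = 2, 3, 5, 11, 13) FAIL Galerkin positivity at windows just above `(log p)/2`; the RH-branch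
witness of this file lives at radius `(log p)/2 + r` with `2ε(r) < λ`.

References: E. Bombieri, *Remarks on Weil's quadratic functional in the theory of prime numbers
I*, Rend. Lincei (9) 11 (2000) 183–233, §3; A. Weil, *Sur les "formules explicites" de la
théorie des nombres premiers*, Comm. Sém. Math. Univ. Lund (1952) 252–265.
-/

set_option linter.dupNamespace false

noncomputable section

open Complex Filter Set MeasureTheory
open scoped Real Topology ComplexConjugate

namespace Summit.RiemannHypothesis.RiemannHypothesis.Theorems.PfPersistenceCoefficientRigidity

open Literature.NumberTheory.LFunctions
open Literature.NumberTheory.LFunctions.WeilConverse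
open Summit.RiemannHypothesis.RiemannHypothesis.Theorems.PfPersistenceFloorRateDichotomy

/-! ## §1 The single-site perturbation of Weil's functional -/

/-- The site-perturbed explicit-formula functional `W_{λ,x₀}(F) = W(F) + λ (F(x₀) + F(-x₀))`:
`λ = Λ(n)/√n`, `x₀ = log n` is the DELETION of the prime power `n` from `ζ`'s weight table (the
prime term of `W` is `-∑ Λ(n) n^{-1/2} (F(log n) + F(-log n))`); `λ < 0` plants a fake prime
power at `e^{x₀}`. [this work] -/
def siteFunctional (lam x₀ : ℝ) (F : ℝ → ℂ) : ℂ :=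
  weilFunctional F + lam * (F x₀ + F (-x₀))

/-- The perturbed quadratic form `g ↦ W_{λ,x₀}(g ⋆ g̃)`. [this work] -/
def siteQuadratic (lam x₀ : ℝ) (g : ℝ → ℂ) : ℂ :=
  siteFunctional lam x₀ (weilConv g (weilReflect g))

/-- Unfolding: `W_{λ,x₀}(g ⋆ g̃) = W(g ⋆ g̃) + λ ((g ⋆ g̃)(x₀) + (g ⋆ g̃)(-x₀))`. [this work] -/
theorem siteQuadratic_eq (lam x₀ : ℝ) (g : ℝ → ℂ) :
    siteQuadratic lam x₀ g = weilQuadratic g +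
      lam * (weilConv g (weilReflect g) x₀ + weilConv g (weilReflect g) (-x₀)) := rfl

/-- At `λ = 0` the perturbed form is Weil's. [this work] -/
theorem siteQuadratic_zero (x₀ : ℝ) (g : ℝ → ℂ) : siteQuadratic 0 x₀ g = weilQuadratic g := by
  rw [siteQuadratic_eq, Complex.ofReal_zero, zero_mul, add_zero]

/-- `λ = 0`: positivity of `W_{0,x₀}` on test functions is `WeilPositivity`. [this work] -/
theorem siteQuadratic_zero_nonneg_iff (x₀ : ℝ) :
    (∀ g : ℝ → ℂ, IsWeilTest g → 0 ≤ (siteQuadratic 0 x₀ g).re) ↔ WeilPositivity := by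
  simp only [WeilPositivity, siteQuadratic_zero]

/-- The centre of the hairline: `W_{0,x₀}` is positive on test functions iff RH (Weil's criterion
`weil_criterion_holds`, imported; no new claim about RH). [cite: Bombieri2000Weil, Thm. 1] -/
theorem siteQuadratic_zero_nonneg_iff_riemannHypothesis (x₀ : ℝ) :
    (∀ g : ℝ → ℂ, IsWeilTest g → 0 ≤ (siteQuadratic 0 x₀ g).re) ↔ RiemannHypothesis :=
  (siteQuadratic_zero_nonneg_iff x₀).trans weil_criterion_holds.symm

/-- Real part of one site term: `Re λ((g ⋆ g̃)(x) + (g ⋆ g̃)(-x)) = 2λ Re (g ⋆ g̃)(x)` (Hermitian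
symmetry `(g ⋆ g̃)(-x) = conj (g ⋆ g̃)(x)`). [this work] -/
theorem re_siteTerm (lam x : ℝ) (g : ℝ → ℂ) :
    ((lam : ℂ) * (weilConv g (weilReflect g) x + weilConv g (weilReflect g) (-x))).re =
      2 * lam * (weilConv g (weilReflect g) x).re := by
  have hk : weilConv g (weilReflect g) (-x) = conj (weilConv g (weilReflect g) x) := by
    rw [← conj_weilConv_weilReflect_neg g x, Complex.conj_conj]
  rw [hk, Complex.add_conj, ← Complex.ofReal_mul, Complex.ofReal_re]
  ring

/-- One site term is at most `2|λ| ‖g‖₂²` in real part (`|(g ⋆ g̃)(x)| ≤ ‖g‖₂²`,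
`norm_weilConv_weilReflect_le`). [this work] -/
theorem re_siteTerm_le (lam x : ℝ) {g : ℝ → ℂ} (hg : IsWeilTest g) :
    ((lam : ℂ) * (weilConv g (weilReflect g) x + weilConv g (weilReflect g) (-x))).re ≤
      2 * |lam| * ∫ u, ‖g u‖ ^ 2 := by
  rw [re_siteTerm]
  have h1 : |(weilConv g (weilReflect g) x).re| ≤ ∫ u, ‖g u‖ ^ 2 :=
    (Complex.abs_re_le_norm _).trans (norm_weilConv_weilReflect_le hg x)
  have h2 : lam * (weilConv g (weilReflect g) x).re ≤ |lam| * ∫ u, ‖g u‖ ^ 2 := by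
    calc lam * (weilConv g (weilReflect g) x).re
        ≤ |lam * (weilConv g (weilReflect g) x).re| := le_abs_self _
      _ = |lam| * |(weilConv g (weilReflect g) x).re| := abs_mul _ _
      _ ≤ |lam| * ∫ u, ‖g u‖ ^ 2 := mul_le_mul_of_nonneg_left h1 (abs_nonneg _)
  linarith

/-- `Re W_{λ,x₀}(g ⋆ g̃) = Re W(g ⋆ g̃) + 2λ Re (g ⋆ g̃)(x₀)`. [this work] -/
theorem siteQuadratic_re (lam x₀ : ℝ) (g : ℝ → ℂ) :
    (siteQuadratic lam x₀ g).re =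
      (weilQuadratic g).re + 2 * lam * (weilConv g (weilReflect g) x₀).re := by
  rw [siteQuadratic_eq, Complex.add_re, re_siteTerm]

/-- A priori bound `Re W_{λ,x₀}(g ⋆ g̃) ≤ Re W(g ⋆ g̃) + 2|λ| ‖g‖₂²`. [this work] -/
theorem siteQuadratic_re_le (lam x₀ : ℝ) {g : ℝ → ℂ} (hg : IsWeilTest g) :
    (siteQuadratic lam x₀ g).re ≤ (weilQuadratic g).re + 2 * |lam| * ∫ u, ‖g u‖ ^ 2 := by
  rw [siteQuadratic_eq, Complex.add_re]
  linarith [re_siteTerm_le lam x₀ hg]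

/-! ## §2 Support algebra of the polarised test `φ + c·φ(· - x₀)` -/

/-- Disjoint supports: if `tsupport φ ⊆ [-r, r]` and `|v - w| > 2r` then `φ(v)·conj φ(w) = 0`.
[this work] -/
theorem mul_conj_eq_zero_of_far {φ : ℝ → ℂ} {r : ℝ} (hφ : tsupport φ ⊆ Icc (-r) r)
    {v w : ℝ} (hvw : 2 * r < |v - w|) : φ v * conj (φ w) = 0 := by
  by_contra h
  have h1 : φ v ≠ 0 := fun h0 ↦ h (by rw [h0, zero_mul])
  have h2 : φ w ≠ 0 := fun h0 ↦ h (by rw [h0, map_zero, mul_zero])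
  have m1 := hφ (subset_tsupport _ (Function.mem_support.2 h1))
  have m2 := hφ (subset_tsupport _ (Function.mem_support.2 h2))
  rw [mem_Icc] at m1 m2
  have : |v - w| ≤ 2 * r := abs_le.2 ⟨by linarith, by linarith⟩
  linarith

/-- Unfolding of Bombieri's polarised test: `(φ + c φ_{x₀})(u) = φ(u) + c φ(u - x₀)`. [folklore] -/
theorem translateMix_apply (φ : ℝ → ℂ) (c : ℂ) (x₀ u : ℝ) :
    translateMix φ c x₀ u = φ u + c * φ (u - x₀) := rfl

/-- **Exact autocorrelation at the site**: for `tsupport φ ⊆ [-r, r]`, `0 < x₀`, `2r < x₀`, the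
autocorrelation of `G = φ + c φ(· - x₀)` at `x₀` is `c ‖φ‖₂²` (the three cross terms have
disjoint supports). [this work] -/
theorem autocorr_translateMix_site {φ : ℝ → ℂ} {r x₀ : ℝ} (hφ : tsupport φ ⊆ Icc (-r) r)
    (hx0 : 0 < x₀) (hx : 2 * r < x₀) (c : ℂ) :
    weilConv (translateMix φ c x₀) (weilReflect (translateMix φ c x₀)) x₀ =
      c * ((∫ u, ‖φ u‖ ^ 2 : ℝ) : ℂ) := by
  rw [weilConv_apply]
  have e : ∀ u : ℝ, translateMix φ c x₀ u * weilReflect (translateMix φ c x₀) (x₀ - u) =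
      c * ((‖φ (u - x₀)‖ ^ 2 : ℝ) : ℂ) := by
    intro u
    have A : φ u * conj (φ (u - x₀)) = 0 :=
      mul_conj_eq_zero_of_far hφ (by rw [sub_sub_cancel, abs_of_pos hx0]; exact hx)
    have B : φ u * conj (φ (u - x₀ - x₀)) = 0 :=
      mul_conj_eq_zero_of_far hφ (by
        rw [show u - (u - x₀ - x₀) = 2 * x₀ by ring, abs_of_pos (by positivity)]; linarith)
    have C : φ (u - x₀) * conj (φ (u - x₀ - x₀)) = 0 :=
      mul_conj_eq_zero_of_far hφ (by rw [sub_sub_cancel, abs_of_pos hx0]; exact hx)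
    have D : φ (u - x₀) * conj (φ (u - x₀)) = ((‖φ (u - x₀)‖ ^ 2 : ℝ) : ℂ) := by
      rw [Complex.mul_conj, Complex.normSq_eq_norm_sq]
    have hr : weilReflect (translateMix φ c x₀) (x₀ - u) =
        conj (φ (u - x₀)) + conj c * conj (φ (u - x₀ - x₀)) := by
      simp only [weilReflect, translateMix_apply, neg_sub, map_add, map_mul]
    rw [hr, translateMix_apply]
    linear_combination A + conj c * B + c * conj c * C + c * D
  simp_rw [e]
  have hI : ∫ u : ℝ, ‖φ (u - x₀)‖ ^ 2 = ∫ u : ℝ, ‖φ u‖ ^ 2 :=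
    integral_sub_right_eq_self (fun u ↦ ‖φ u‖ ^ 2) x₀
  rw [integral_const_mul, integral_complex_ofReal, hI]

/-! ## §3 The RH branch: Bombieri polarisation with a phase -/

/-- Under RH every zero-side limit of `g ⋆ g̃` has non-negative real part (Weil's criterion,
direct half, and uniqueness of the limit). [cite: Bombieri2000Weil, Thm. 1] -/
theorem zeroSide_nonneg_of_riemannHypothesis (hRH : RiemannHypothesis) :
    ∀ g : ℝ → ℂ, IsWeilTest g →
      ∀ Z : ℂ, HasWeilZeroSide (weilConv g (weilReflect g)) Z → 0 ≤ Z.re := by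
  intro g hg Z hZ
  have hW : WeilPositivity := weil_criterion_holds.1 hRH
  rw [tendsto_nhds_unique hZ (explicit_formula_holds (hg.weilConv hg.weilReflect))]
  exact hW g hg

/-- **Polarisation identity** (RH-free): `Re W(G ⋆ G̃) = (1 + |c|²) Re W(φ ⋆ φ̃) + 2 Re(c·B_φ(x₀))`
for `G = φ + c φ(· - x₀)`, `B_φ = WeilConverse.expSum φ`. [cite: Bombieri2000Weil, §3] -/
theorem re_weilQuadratic_translateMix {φ : ℝ → ℂ} (hφ : IsWeilTest φ) (c : ℂ) (x₀ : ℝ) :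
    (weilQuadratic (translateMix φ c x₀)).re =
      (1 + Complex.normSq c) * (weilQuadratic φ).re + 2 * (c * expSum φ x₀).re := by
  rw [← combShapeDetection_zeroForm_eq_weilQuadratic (isWeilTest_translateMix hφ c x₀),
    ← combShapeDetection_zeroForm_eq_weilQuadratic hφ, zeroForm_translateMix hφ c x₀]
  have hA : expSum' φ x₀ = conj (expSum φ x₀) := by
    rw [← conj_expSum' φ x₀, Complex.conj_conj]
  rw [hA, ← map_mul]
  simp only [Complex.add_re, Complex.re_ofReal_mul, Complex.conj_re]
  ring

/-- **The phase choice** (pure algebra): if `‖B‖ ≤ w` and `2w < |s|` (`s` real) then some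
unimodular `c` has `2w + 2 Re(c (B + s)) < 0` — namely `c = -conj(B + s)/|B + s|`, value
`2w - 2|B + s|`. [this work] -/
theorem exists_phase_neg (B : ℂ) {w s : ℝ} (hBw : ‖B‖ ≤ w) (hs : 2 * w < |s|) :
    ∃ c : ℂ, Complex.normSq c = 1 ∧ 2 * w + 2 * (c * (B + s)).re < 0 := by
  set M : ℂ := B + s with hM
  have hMgt : w < ‖M‖ := by
    have h2 : ‖(s : ℂ)‖ ≤ ‖M‖ + ‖B‖ := by
      have h3 : (s : ℂ) = M - B := by rw [hM]; ring
      rw [h3]; exact norm_sub_le M B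
    rw [Complex.norm_real, Real.norm_eq_abs] at h2
    linarith [norm_nonneg B]
  have hM0 : M ≠ 0 := by
    intro h; rw [h, norm_zero] at hMgt; linarith [norm_nonneg B]
  have hn0 : ‖M‖ ≠ 0 := norm_ne_zero_iff.2 hM0
  have hn : (‖M‖ : ℂ) ≠ 0 := by exact_mod_cast hn0
  set c : ℂ := -conj M / (‖M‖ : ℂ) with hc
  have hcM : c * M = -(‖M‖ : ℂ) := by
    rw [hc, div_mul_eq_mul_div, neg_mul, Complex.conj_mul', neg_div]
    congr 1
    rw [sq, mul_div_assoc, div_self hn, mul_one]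
  have hc1 : Complex.normSq c = 1 := by
    rw [Complex.normSq_eq_norm_sq, hc, norm_div, norm_neg, Complex.norm_conj, Complex.norm_real,
      Real.norm_eq_abs, abs_norm, div_self hn0, one_pow]
  refine ⟨c, hc1, ?_⟩
  have e3 : (c * M).re = -‖M‖ := by rw [hcM, Complex.neg_re, Complex.ofReal_re]
  linarith

/-- **RH branch.** Under RH, if `tsupport φ ⊆ [-r, r]`, `2r < x₀` and
`2 Re W(φ ⋆ φ̃) < |λ| ‖φ‖₂²`, some unimodular phase `c` makes `Re W_{λ,x₀}(G ⋆ G̃) < 0` for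
`G = φ + c φ(· - x₀)` (value `2w₀ - 2|B_φ(x₀) + λ‖φ‖₂²|`, `|B_φ(x₀)| ≤ w₀` by `norm_expSum_le`).
[this work] -/
theorem exists_siteQuadratic_neg_of_riemannHypothesis (hRH : RiemannHypothesis)
    {φ : ℝ → ℂ} (hφ : IsWeilTest φ) {r x₀ lam : ℝ} (hφr : tsupport φ ⊆ Icc (-r) r)
    (hx0 : 0 < x₀) (hx : 2 * r < x₀)
    (hlam : 2 * (weilQuadratic φ).re < |lam| * ∫ u, ‖φ u‖ ^ 2) :
    ∃ c : ℂ, Complex.normSq c = 1 ∧ (siteQuadratic lam x₀ (translateMix φ c x₀)).re < 0 := by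
  have hBw : ‖expSum φ x₀‖ ≤ (weilQuadratic φ).re := by
    have h := norm_expSum_le (zeroSide_nonneg_of_riemannHypothesis hRH) hφ x₀
    rwa [combShapeDetection_zeroForm_eq_weilQuadratic hφ] at h
  have hq0 : 0 ≤ ∫ u, ‖φ u‖ ^ 2 := integral_nonneg fun _ ↦ by positivity
  obtain ⟨c, hc1, hneg⟩ := exists_phase_neg (expSum φ x₀) hBw
    (s := lam * ∫ u, ‖φ u‖ ^ 2) (by rwa [abs_mul, abs_of_nonneg hq0])
  refine ⟨c, hc1, ?_⟩
  rw [siteQuadratic_re, autocorr_translateMix_site hφr hx0 hx c,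
    re_weilQuadratic_translateMix hφ c x₀, hc1]
  have e : (c * (expSum φ x₀ + ((lam * ∫ u, ‖φ u‖ ^ 2 : ℝ) : ℂ))).re =
      (c * expSum φ x₀).re + lam * (c * ((∫ u, ‖φ u‖ ^ 2 : ℝ) : ℂ)).re := by
    rw [mul_add, Complex.add_re, Complex.ofReal_mul]
    simp only [Complex.mul_re, Complex.mul_im, Complex.ofReal_re, Complex.ofReal_im]
    ring
  rw [e] at hneg
  linarith

/-! ## §4 The ¬RH branch: the ground energy sinks below any bounded perturbation -/

/-- **¬RH branch.** If RH fails then for every `K, a₀` some normalised test of some window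
`a ≥ a₀`, `a > 0`, has `Re W(g ⋆ g̃) < -K` (`weilGroundEnergy_sinks_of_offline_zero` at rate
`δ = 0`). [this work] -/
theorem exists_weilQuadratic_lt_of_not_riemannHypothesis (hRH : ¬ RiemannHypothesis)
    (K a₀ : ℝ) :
    ∃ a : ℝ, a₀ ≤ a ∧ 0 < a ∧ ∃ g : ℝ → ℂ, IsWeilTest g ∧ tsupport g ⊆ Icc (-a) a ∧
      (∫ u, ‖g u‖ ^ 2) = 1 ∧ (weilQuadratic g).re < -K := by
  have h : ¬ RiemannHypothesisStrip := fun hS ↦ hRH (riemannHypothesis_iff_strip_holds.2 hS)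
  unfold RiemannHypothesisStrip at h
  push Not at h
  obtain ⟨s, hs, h0, h1, hne⟩ := h
  have hρ := ZetaZeros.riemannZetaNontrivialZeros.mem_iff'.2 ⟨hs, h0, h1⟩
  have hβ : (0 : ℝ) / 2 < |s.re - 1 / 2| := by
    rw [zero_div]; exact abs_pos.2 (sub_ne_zero.2 hne)
  obtain ⟨a, ha, hlt⟩ := weilGroundEnergy_sinks_of_offline_zero hρ le_rfl hβ K (max a₀ 1)
  have ha0 : 0 < a := lt_of_lt_of_le one_pos ((le_max_right _ _).trans ha)
  have hlt' : sInf (weilWindowSphereValues (fun _ ↦ True) a) < -K := by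
    rw [← weilGroundEnergy_eq_sInf]; simpa using hlt
  obtain ⟨x, ⟨g, hg, hsupp, -, hn, rfl⟩, hx⟩ :=
    exists_lt_of_csInf_lt (weilWindowSphereValues_top_nonempty ha0) hlt'
  exact ⟨a, (le_max_left _ _).trans ha, ha0, g, hg, hsupp, hn, hx⟩

/-- **¬RH branch for the site form**: if RH fails, every `W_{λ,x₀}` takes a negative real value on
some normalised test of some window `a ≥ a₀`. [this work] -/
theorem exists_siteQuadratic_neg_of_not_riemannHypothesis (hRH : ¬ RiemannHypothesis)
    (lam x₀ a₀ : ℝ) :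
    ∃ a : ℝ, a₀ ≤ a ∧ ∃ g : ℝ → ℂ, IsWeilTest g ∧ tsupport g ⊆ Icc (-a) a ∧
      (∫ u, ‖g u‖ ^ 2) = 1 ∧ (siteQuadratic lam x₀ g).re < 0 := by
  obtain ⟨a, ha, -, g, hg, hsupp, hn, hlt⟩ :=
    exists_weilQuadratic_lt_of_not_riemannHypothesis hRH (2 * |lam|) a₀
  refine ⟨a, ha, g, hg, hsupp, hn, ?_⟩
  have hle := siteQuadratic_re_le lam x₀ hg
  rw [hn, mul_one] at hle
  linarith

/-! ## §5 Detection and the hairline (RH-free) -/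

/-- **DETECTION BY A CHEAP TEST (RH-free).** If a test `φ` of radius `r < x₀/2` has
`2 Re W(φ ⋆ φ̃) < |λ| ‖φ‖₂²`, then some test function `g` has `Re W_{λ,x₀}(g ⋆ g̃) < 0`.  Proof by
cases on RH (§3 / §4); nothing about RH is claimed. [this work] -/
theorem exists_siteQuadratic_neg_of_test {φ : ℝ → ℂ} (hφ : IsWeilTest φ) {r x₀ lam : ℝ}
    (hφr : tsupport φ ⊆ Icc (-r) r) (hx0 : 0 < x₀) (hx : 2 * r < x₀)
    (hlam : 2 * (weilQuadratic φ).re < |lam| * ∫ u, ‖φ u‖ ^ 2) :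
    ∃ g : ℝ → ℂ, IsWeilTest g ∧ (siteQuadratic lam x₀ g).re < 0 := by
  by_cases hRH : RiemannHypothesis
  · obtain ⟨c, -, hneg⟩ := exists_siteQuadratic_neg_of_riemannHypothesis hRH hφ hφr hx0 hx hlam
    exact ⟨_, isWeilTest_translateMix hφ c x₀, hneg⟩
  · obtain ⟨a, -, g, hg, -, -, hneg⟩ :=
      exists_siteQuadratic_neg_of_not_riemannHypothesis hRH lam x₀ 0
    exact ⟨g, hg, hneg⟩

/-- **DETECTION BY THE GROUND ENERGY (RH-free).** If `2 ε(r) < |λ|` for some `0 < r < x₀/2`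
(`ε = weilGroundEnergy`), some test function has `Re W_{λ,x₀}(g ⋆ g̃) < 0`. [this work] -/
theorem exists_siteQuadratic_neg_of_weilGroundEnergy_lt {r x₀ lam : ℝ} (hr : 0 < r)
    (hx : 2 * r < x₀) (h : 2 * weilGroundEnergy r < |lam|) :
    ∃ g : ℝ → ℂ, IsWeilTest g ∧ (siteQuadratic lam x₀ g).re < 0 := by
  have h' : sInf (weilWindowSphereValues (fun _ ↦ True) r) < |lam| / 2 := by
    rw [← weilGroundEnergy_eq_sInf]; linarith
  obtain ⟨x, ⟨φ, hφ, hs, -, hn, rfl⟩, hx'⟩ :=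
    exists_lt_of_csInf_lt (weilWindowSphereValues_top_nonempty hr) h'
  exact exists_siteQuadratic_neg_of_test hφ hs (by linarith) hx (by rw [hn, mul_one]; linarith)

/-- **THE HAIRLINE (RH-free).** If `W_{λ,x₀}` is positive on test functions then `|λ| ≤ 2 ε(r)` for
every `0 < r < x₀/2` — a theorem ABOUT positive perturbations; no perturbation is claimed positive.
[this work] -/
theorem abs_le_two_mul_weilGroundEnergy_of_nonneg {lam x₀ : ℝ}
    (hP : ∀ g : ℝ → ℂ, IsWeilTest g → 0 ≤ (siteQuadratic lam x₀ g).re) {r : ℝ} (hr : 0 < r)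
    (hx : 2 * r < x₀) : |lam| ≤ 2 * weilGroundEnergy r := by
  refine not_lt.1 fun h ↦ ?_
  obtain ⟨g, hg, hneg⟩ := exists_siteQuadratic_neg_of_weilGroundEnergy_lt hr hx h
  exact absurd (hP g hg) (not_le.2 hneg)

/-- A positive single-site perturbation at `x₀ > 0` forces `ε(r) ≥ 0` on `0 < r < x₀/2`. [this work] -/
theorem weilGroundEnergy_nonneg_of_nonneg {lam x₀ : ℝ}
    (hP : ∀ g : ℝ → ℂ, IsWeilTest g → 0 ≤ (siteQuadratic lam x₀ g).re) {r : ℝ} (hr : 0 < r)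
    (hx : 2 * r < x₀) : 0 ≤ weilGroundEnergy r := by
  have := abs_le_two_mul_weilGroundEnergy_of_nonneg hP hr hx
  linarith [abs_nonneg lam]

/-- **HAIRLINE WIDTH, doubly exponential (RH-free)**: with the constants `c, C` of the
unconditional decay `ε(a) ≤ C e^{-c e^{2a}}` (`weilGroundEnergy_exp_exp_decay`), every single-site
perturbation that is positive on test functions obeys `|λ| ≤ 2C·exp(-c·e^{2r})` for all
`1 ≤ r < x₀/2`. [this work] -/
theorem siteQuadratic_hairline : ∃ c : ℝ, 0 < c ∧ ∃ C : ℝ, ∀ lam x₀ : ℝ,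
    (∀ g : ℝ → ℂ, IsWeilTest g → 0 ≤ (siteQuadratic lam x₀ g).re) → ∀ r : ℝ, 1 ≤ r → 2 * r < x₀ →
      |lam| ≤ 2 * C * Real.exp (-c * Real.exp (2 * r)) := by
  obtain ⟨c, hc, C, hC⟩ := weilGroundEnergy_exp_exp_decay
  refine ⟨c, hc, C, fun lam x₀ hP r hr hx ↦ ?_⟩
  have h1 := abs_le_two_mul_weilGroundEnergy_of_nonneg hP (by linarith) hx
  have h2 := hC r hr
  linarith

end Summit.RiemannHypothesis.RiemannHypothesis.Theorems.PfPersistenceCoefficientRigidity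

end
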